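import Literature.Topology.FourManifolds.GluingConstruction
import HarnessLib

/-!
# The smooth mapping torus as an open gluing (construction)

For a diffeomorphism `φ` of a boundaryless smooth manifold `M` (model `I` on `E`) and a linear
identification `L : E × ℝ ≃L E_P`, we construct the smooth mapping torus
`T_φ = M × ℝ / (x, s) ∼ (φ x, s + 1)` as the pushout (`Literature.Topology.FourManifolds.SmoothGlueData.Glued`) of the two open
cylinders `M × (0, 1)` and `M × (1/2, 3/2)` along the partial diffeomorphism
`(x, s) ↦ (x, s)` for `s > 1/2`, `(x, s) ↦ (φ x, s + 1)` for `s < 1/2` (defined off `s = 1/2`), whose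
graph is exactly `Literature.mappingTorusRel φ` (Cappell–Shaneson, *Some new four-manifolds*, Ann. of
Math. 104 (1976), §1; Hatcher, *Algebraic Topology*, Ex. 2.48; the relational predicate
`Literature.Topology.FourManifolds.IsMappingTorusOf` of `Literature.Topology.FourManifolds.MappingTorus`).

## Main definitions and results

* `Literature.mappingTorusGlue φ`: the gluing partial homeomorphism `M × (0,1) ⇀ M × (1/2, 3/2)`;
  `Literature.Topology.FourManifolds.mappingTorusRel_iff_glue`: its graph is `mappingTorusRel φ`.
* `Literature.mappingTorusGlueData φ L : SmoothGlueData …` and `Literature.MappingTorusGlued φ L := (…).Glued`,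
  a smooth manifold charted on `E_P`, Hausdorff (`t2Space`), compact for compact `M`
  (`compactSpace`), second countable.
* `Literature.Topology.FourManifolds.isOpenGluingWith_mappingTorusGlued`: `MappingTorusGlued φ L` is an open gluing of the two
  cylinders along `mappingTorusRel φ`, with the canonical maps `inl`, `inr` as witnesses; hence
  `Literature.Topology.FourManifolds.isMappingTorusOf_mappingTorusGlued`.
-/

open scoped Manifold ContDiff Topology
open Set Function

noncomputable section

namespace Literature.Topology.FourManifolds

universe u

variable {E H : Type*} [NormedAddCommGroup E] [NormedSpace ℝ E] [TopologicalSpace H]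
  {I : ModelWithCorners ℝ E H} {M : Type u}

/-! ### Interval bookkeeping -/

section Pieces

/-- Membership in the first piece `(0, 1)`. [folklore] -/
theorem mem_mappingTorusPieceOne {s : ℝ} : s ∈ mappingTorusPieceOne ↔ 0 < s ∧ s < 1 := Iff.rfl

/-- Membership in the second piece `(1/2, 3/2)`. [folklore] -/
theorem mem_mappingTorusPieceTwo {t : ℝ} : t ∈ mappingTorusPieceTwo ↔ 1 / 2 < t ∧ t < 3 / 2 :=
  Iff.rfl

/-- A point of the first piece lies in `(0, 1)`. [folklore] -/
theorem coe_prop_pieceOne (s : mappingTorusPieceOne) : 0 < (s : ℝ) ∧ (s : ℝ) < 1 := s.2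

/-- A point of the second piece lies in `(1/2, 3/2)`. [folklore] -/
theorem coe_prop_pieceTwo (t : mappingTorusPieceTwo) : 1 / 2 < (t : ℝ) ∧ (t : ℝ) < 3 / 2 := t.2

/-- For `s ∈ (0, 1/2)`, `s + 1 ∈ (1/2, 3/2)`. [folklore] -/
theorem add_one_mem_pieceTwo {s : ℝ} (hs : 0 < s ∧ s < 1) (h : s < 1 / 2) :
    s + 1 ∈ mappingTorusPieceTwo := by
  rw [mem_mappingTorusPieceTwo]; constructor <;> linarith

/-- For `s ∈ (1/2, 1)`, `s ∈ (1/2, 3/2)`. [folklore] -/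
theorem mem_pieceTwo_of_gt {s : ℝ} (hs : 0 < s ∧ s < 1) (h : 1 / 2 < s) :
    s ∈ mappingTorusPieceTwo := by
  rw [mem_mappingTorusPieceTwo]; constructor <;> linarith

/-- `1 ∈ (1/2, 3/2)`. [folklore] -/
theorem one_mem_pieceTwo : (1 : ℝ) ∈ mappingTorusPieceTwo := by
  rw [mem_mappingTorusPieceTwo]; norm_num

/-- For `t ∈ (1, 3/2)`, `t - 1 ∈ (0, 1)`. [folklore] -/
theorem sub_one_mem_pieceOne {t : ℝ} (ht : 1 / 2 < t ∧ t < 3 / 2) (h : 1 < t) :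
    t - 1 ∈ mappingTorusPieceOne := by
  rw [mem_mappingTorusPieceOne]; constructor <;> linarith

/-- For `t ∈ (1/2, 1)`, `t ∈ (0, 1)`. [folklore] -/
theorem mem_pieceOne_of_lt {t : ℝ} (ht : 1 / 2 < t ∧ t < 3 / 2) (h : t < 1) :
    t ∈ mappingTorusPieceOne := by
  rw [mem_mappingTorusPieceOne]; constructor <;> linarith

/-- `1/2 ∈ (0, 1)`. [folklore] -/
theorem half_mem_pieceOne : (1 / 2 : ℝ) ∈ mappingTorusPieceOne := by
  rw [mem_mappingTorusPieceOne]; norm_num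

/-- The coordinate `(0, 1) → ℝ` is smooth. [folklore] -/
theorem contMDiff_coe_pieceOne : ContMDiff 𝓘(ℝ, ℝ) 𝓘(ℝ, ℝ) ∞ (Subtype.val : mappingTorusPieceOne → ℝ) :=
  contMDiff_subtype_val

/-- The coordinate `(1/2, 3/2) → ℝ` is smooth. [folklore] -/
theorem contMDiff_coe_pieceTwo : ContMDiff 𝓘(ℝ, ℝ) 𝓘(ℝ, ℝ) ∞ (Subtype.val : mappingTorusPieceTwo → ℝ) :=
  contMDiff_subtype_val

end Pieces

/-! ### The gluing maps -/

section GlueMaps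

variable (φ ψ : M → M)

/-- The forward gluing map `M × (0, 1) → M × (1/2, 3/2)`: `(x, s) ↦ (φ x, s + 1)` for `s < 1/2`,
`(x, s) ↦ (x, s)` for `s > 1/2` (junk value at `s = 1/2`). [folklore] -/
def mtGlueFun (a : M × mappingTorusPieceOne) : M × mappingTorusPieceTwo :=
  if h : (a.2 : ℝ) < 1 / 2 then (φ a.1, ⟨a.2 + 1, add_one_mem_pieceTwo (coe_prop_pieceOne a.2) h⟩)
  else if h' : 1 / 2 < (a.2 : ℝ) then (a.1, ⟨a.2, mem_pieceTwo_of_gt (coe_prop_pieceOne a.2) h'⟩)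
  else (a.1, ⟨1, one_mem_pieceTwo⟩)

/-- The backward gluing map `M × (1/2, 3/2) → M × (0, 1)`: `(y, t) ↦ (ψ y, t - 1)` for `t > 1`,
`(y, t) ↦ (y, t)` for `t < 1` (junk value at `t = 1`); here `ψ = φ⁻¹`. [folklore] -/
def mtGlueInv (b : M × mappingTorusPieceTwo) : M × mappingTorusPieceOne :=
  if h : 1 < (b.2 : ℝ) then (ψ b.1, ⟨b.2 - 1, sub_one_mem_pieceOne (coe_prop_pieceTwo b.2) h⟩)
  else if h' : (b.2 : ℝ) < 1 then (b.1, ⟨b.2, mem_pieceOne_of_lt (coe_prop_pieceTwo b.2) h'⟩)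
  else (b.1, ⟨1 / 2, half_mem_pieceOne⟩)

variable {φ ψ}

/-- The forward gluing map on `s < 1/2` is `(x, s) ↦ (φ x, s + 1)`. [folklore] -/
theorem mtGlueFun_of_lt {a : M × mappingTorusPieceOne} (h : (a.2 : ℝ) < 1 / 2) :
    mtGlueFun φ a = (φ a.1, ⟨a.2 + 1, add_one_mem_pieceTwo (coe_prop_pieceOne a.2) h⟩) := by
  rw [mtGlueFun, dif_pos h]

/-- The forward gluing map on `s > 1/2` is the identity `(x, s) ↦ (x, s)`. [folklore] -/
theorem mtGlueFun_of_gt {a : M × mappingTorusPieceOne} (h : 1 / 2 < (a.2 : ℝ)) :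
    mtGlueFun φ a = (a.1, ⟨a.2, mem_pieceTwo_of_gt (coe_prop_pieceOne a.2) h⟩) := by
  rw [mtGlueFun, dif_neg (not_lt.2 h.le), dif_pos h]

/-- The backward gluing map on `t > 1` is `(y, t) ↦ (ψ y, t - 1)`. [folklore] -/
theorem mtGlueInv_of_gt {b : M × mappingTorusPieceTwo} (h : 1 < (b.2 : ℝ)) :
    mtGlueInv ψ b = (ψ b.1, ⟨b.2 - 1, sub_one_mem_pieceOne (coe_prop_pieceTwo b.2) h⟩) := by
  rw [mtGlueInv, dif_pos h]

/-- The backward gluing map on `t < 1` is the identity `(y, t) ↦ (y, t)`. [folklore] -/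
theorem mtGlueInv_of_lt {b : M × mappingTorusPieceTwo} (h : (b.2 : ℝ) < 1) :
    mtGlueInv ψ b = (b.1, ⟨b.2, mem_pieceOne_of_lt (coe_prop_pieceTwo b.2) h⟩) := by
  rw [mtGlueInv, dif_neg (not_lt.2 h.le), dif_pos h]

/-- Value of the first component and of the real coordinate of the forward map, `s < 1/2`. [folklore] -/
theorem mtGlueFun_fst_snd_of_lt {a : M × mappingTorusPieceOne} (h : (a.2 : ℝ) < 1 / 2) :
    (mtGlueFun φ a).1 = φ a.1 ∧ ((mtGlueFun φ a).2 : ℝ) = a.2 + 1 := by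
  rw [mtGlueFun_of_lt h]; exact ⟨rfl, rfl⟩

/-- Value of the first component and of the real coordinate of the forward map, `s > 1/2`. [folklore] -/
theorem mtGlueFun_fst_snd_of_gt {a : M × mappingTorusPieceOne} (h : 1 / 2 < (a.2 : ℝ)) :
    (mtGlueFun φ a).1 = a.1 ∧ ((mtGlueFun φ a).2 : ℝ) = a.2 := by
  rw [mtGlueFun_of_gt h]; exact ⟨rfl, rfl⟩

/-- Value of the first component and of the real coordinate of the backward map, `t > 1`. [folklore] -/
theorem mtGlueInv_fst_snd_of_gt {b : M × mappingTorusPieceTwo} (h : 1 < (b.2 : ℝ)) :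
    (mtGlueInv ψ b).1 = ψ b.1 ∧ ((mtGlueInv ψ b).2 : ℝ) = b.2 - 1 := by
  rw [mtGlueInv_of_gt h]; exact ⟨rfl, rfl⟩

/-- Value of the first component and of the real coordinate of the backward map, `t < 1`. [folklore] -/
theorem mtGlueInv_fst_snd_of_lt {b : M × mappingTorusPieceTwo} (h : (b.2 : ℝ) < 1) :
    (mtGlueInv ψ b).1 = b.1 ∧ ((mtGlueInv ψ b).2 : ℝ) = b.2 := by
  rw [mtGlueInv_of_lt h]; exact ⟨rfl, rfl⟩

/-- Extensionality for points of the cylinders. [folklore] -/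
theorem Prod.ext_pieceTwo {b b' : M × mappingTorusPieceTwo} (h1 : b.1 = b'.1)
    (h2 : (b.2 : ℝ) = b'.2) : b = b' :=
  Prod.ext h1 (Subtype.ext h2)

/-- Extensionality for points of the cylinders. [folklore] -/
theorem Prod.ext_pieceOne {a a' : M × mappingTorusPieceOne} (h1 : a.1 = a'.1)
    (h2 : (a.2 : ℝ) = a'.2) : a = a' :=
  Prod.ext h1 (Subtype.ext h2)

/-! #### Smoothness -/

variable [TopologicalSpace M] [ChartedSpace H M]

/-- The forward gluing map is smooth off `s = 1/2`, for smooth `φ`. [folklore] -/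
theorem contMDiffOn_mtGlueFun (hφ : ContMDiff I I ∞ φ) :
    ContMDiffOn (I.prod 𝓘(ℝ, ℝ)) (I.prod 𝓘(ℝ, ℝ)) ∞ (mtGlueFun φ)
      {a : M × mappingTorusPieceOne | (a.2 : ℝ) ≠ 1 / 2} := by
  intro a ha
  apply ContMDiffAt.contMDiffWithinAt
  rw [contMDiffAt_prod_iff]
  have hval : ContMDiff (I.prod 𝓘(ℝ, ℝ)) 𝓘(ℝ, ℝ) ∞ fun a : M × mappingTorusPieceOne ↦ (a.2 : ℝ) :=
    contMDiff_coe_pieceOne.comp contMDiff_snd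
  rcases (Ne.lt_or_gt ha) with h | h
  · -- `s < 1/2`: the map is `(φ x, s + 1)` near `a`
    have hev : ∀ᶠ a' in 𝓝 a, (a'.2 : ℝ) < 1 / 2 :=
      (isOpen_lt hval.continuous continuous_const).mem_nhds h
    constructor
    · refine ((hφ.comp contMDiff_fst).contMDiffAt).congr_of_eventuallyEq ?_
      filter_upwards [hev] with a' ha'
      exact (mtGlueFun_fst_snd_of_lt ha').1
    · rw [← ContMDiffAt.subtypeVal_comp_iff]
      have h2 : ContMDiffAt (I.prod 𝓘(ℝ, ℝ)) 𝓘(ℝ, ℝ) ∞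
          (fun a' : M × mappingTorusPieceOne ↦ (a'.2 : ℝ) + 1) a :=
        ((contDiff_id.add contDiff_const).contDiffAt).comp_contMDiffAt
          (f := fun a' : M × mappingTorusPieceOne ↦ (a'.2 : ℝ)) hval.contMDiffAt
      refine h2.congr_of_eventuallyEq ?_
      filter_upwards [hev] with a' ha'
      exact (mtGlueFun_fst_snd_of_lt ha').2
  · -- `s > 1/2`: the map is `(x, s)` near `a`
    have hev : ∀ᶠ a' in 𝓝 a, 1 / 2 < (a'.2 : ℝ) :=
      (isOpen_lt continuous_const hval.continuous).mem_nhds h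
    constructor
    · refine (contMDiff_fst.contMDiffAt).congr_of_eventuallyEq ?_
      filter_upwards [hev] with a' ha'
      exact (mtGlueFun_fst_snd_of_gt ha').1
    · rw [← ContMDiffAt.subtypeVal_comp_iff]
      refine hval.contMDiffAt.congr_of_eventuallyEq ?_
      filter_upwards [hev] with a' ha'
      exact (mtGlueFun_fst_snd_of_gt ha').2

/-- The backward gluing map is smooth off `t = 1`, for smooth `ψ`. [folklore] -/
theorem contMDiffOn_mtGlueInv (hψ : ContMDiff I I ∞ ψ) :
    ContMDiffOn (I.prod 𝓘(ℝ, ℝ)) (I.prod 𝓘(ℝ, ℝ)) ∞ (mtGlueInv ψ)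
      {b : M × mappingTorusPieceTwo | (b.2 : ℝ) ≠ 1} := by
  intro b hb
  apply ContMDiffAt.contMDiffWithinAt
  rw [contMDiffAt_prod_iff]
  have hval : ContMDiff (I.prod 𝓘(ℝ, ℝ)) 𝓘(ℝ, ℝ) ∞ fun b : M × mappingTorusPieceTwo ↦ (b.2 : ℝ) :=
    contMDiff_coe_pieceTwo.comp contMDiff_snd
  rcases (Ne.lt_or_gt hb) with h | h
  · -- `t < 1`: the map is `(y, t)` near `b`
    have hev : ∀ᶠ b' in 𝓝 b, (b'.2 : ℝ) < 1 :=
      (isOpen_lt hval.continuous continuous_const).mem_nhds h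
    constructor
    · refine (contMDiff_fst.contMDiffAt).congr_of_eventuallyEq ?_
      filter_upwards [hev] with b' hb'
      exact (mtGlueInv_fst_snd_of_lt hb').1
    · rw [← ContMDiffAt.subtypeVal_comp_iff]
      refine hval.contMDiffAt.congr_of_eventuallyEq ?_
      filter_upwards [hev] with b' hb'
      exact (mtGlueInv_fst_snd_of_lt hb').2
  · -- `t > 1`: the map is `(ψ y, t - 1)` near `b`
    have hev : ∀ᶠ b' in 𝓝 b, 1 < (b'.2 : ℝ) :=
      (isOpen_lt continuous_const hval.continuous).mem_nhds h
    constructor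
    · refine ((hψ.comp contMDiff_fst).contMDiffAt).congr_of_eventuallyEq ?_
      filter_upwards [hev] with b' hb'
      exact (mtGlueInv_fst_snd_of_gt hb').1
    · rw [← ContMDiffAt.subtypeVal_comp_iff]
      have h2 : ContMDiffAt (I.prod 𝓘(ℝ, ℝ)) 𝓘(ℝ, ℝ) ∞
          (fun b' : M × mappingTorusPieceTwo ↦ (b'.2 : ℝ) - 1) b :=
        ((contDiff_id.sub contDiff_const).contDiffAt).comp_contMDiffAt
          (f := fun b' : M × mappingTorusPieceTwo ↦ (b'.2 : ℝ)) hval.contMDiffAt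
      refine h2.congr_of_eventuallyEq ?_
      filter_upwards [hev] with b' hb'
      exact (mtGlueInv_fst_snd_of_gt hb').2

end GlueMaps

/-! ### The gluing partial diffeomorphism -/

section Glue

variable [TopologicalSpace M] [ChartedSpace H M] (φ : M ≃ₘ⟮I, I⟯ M)

/-- **The mapping torus gluing map** `M × (0, 1) ⇀ M × (1/2, 3/2)`, defined off `s = 1/2`, onto the
complement of `t = 1`: identity on `M × (1/2, 1)` and `(x, s) ↦ (φ x, s + 1)` on `M × (0, 1/2)`
(Cappell–Shaneson 1976, §1; Hatcher, Ex. 2.48). [folklore] -/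
def mappingTorusGlue : OpenPartialHomeomorph (M × mappingTorusPieceOne) (M × mappingTorusPieceTwo) where
  toFun := mtGlueFun φ
  invFun := mtGlueInv φ.symm
  source := {a | (a.2 : ℝ) ≠ 1 / 2}
  target := {b | (b.2 : ℝ) ≠ 1}
  map_source' a ha := by
    have hs := coe_prop_pieceOne a.2
    rcases Ne.lt_or_gt ha with h | h
    · show ((mtGlueFun φ a).2 : ℝ) ≠ 1
      rw [(mtGlueFun_fst_snd_of_lt h).2]; linarith
    · show ((mtGlueFun φ a).2 : ℝ) ≠ 1
      rw [(mtGlueFun_fst_snd_of_gt h).2]; linarith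
  map_target' b hb := by
    have ht := coe_prop_pieceTwo b.2
    rcases Ne.lt_or_gt hb with h | h
    · show ((mtGlueInv φ.symm b).2 : ℝ) ≠ 1 / 2
      rw [(mtGlueInv_fst_snd_of_lt h).2]; linarith
    · show ((mtGlueInv φ.symm b).2 : ℝ) ≠ 1 / 2
      rw [(mtGlueInv_fst_snd_of_gt h).2]; linarith
  left_inv' a ha := by
    have hs := coe_prop_pieceOne a.2
    rcases Ne.lt_or_gt ha with h | h
    · have h1 := mtGlueFun_fst_snd_of_lt (φ := φ) h
      have hgt : 1 < ((mtGlueFun φ a).2 : ℝ) := by rw [h1.2]; linarith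
      have h2 := mtGlueInv_fst_snd_of_gt (ψ := φ.symm) hgt
      exact Prod.ext_pieceOne (by rw [h2.1, h1.1, Diffeomorph.symm_apply_apply])
        (by rw [h2.2, h1.2]; ring)
    · have h1 := mtGlueFun_fst_snd_of_gt (φ := φ) h
      have hlt : ((mtGlueFun φ a).2 : ℝ) < 1 := by rw [h1.2]; linarith
      have h2 := mtGlueInv_fst_snd_of_lt (ψ := φ.symm) hlt
      exact Prod.ext_pieceOne (by rw [h2.1, h1.1]) (by rw [h2.2, h1.2])
  right_inv' b hb := by
    have ht := coe_prop_pieceTwo b.2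
    rcases Ne.lt_or_gt hb with h | h
    · have h1 := mtGlueInv_fst_snd_of_lt (ψ := φ.symm) h
      have hgt : 1 / 2 < ((mtGlueInv φ.symm b).2 : ℝ) := by rw [h1.2]; linarith
      have h2 := mtGlueFun_fst_snd_of_gt (φ := φ) hgt
      exact Prod.ext_pieceTwo (by rw [h2.1, h1.1]) (by rw [h2.2, h1.2])
    · have h1 := mtGlueInv_fst_snd_of_gt (ψ := φ.symm) h
      have hlt : ((mtGlueInv φ.symm b).2 : ℝ) < 1 / 2 := by rw [h1.2]; linarith
      have h2 := mtGlueFun_fst_snd_of_lt (φ := φ) hlt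
      exact Prod.ext_pieceTwo (by rw [h2.1, h1.1, Diffeomorph.apply_symm_apply])
        (by rw [h2.2, h1.2]; ring)
  open_source :=
    isOpen_ne_fun (contMDiff_coe_pieceOne.continuous.comp continuous_snd) continuous_const
  open_target :=
    isOpen_ne_fun (contMDiff_coe_pieceTwo.continuous.comp continuous_snd) continuous_const
  continuousOn_toFun := (contMDiffOn_mtGlueFun φ.contMDiff).continuousOn
  continuousOn_invFun := (contMDiffOn_mtGlueInv φ.symm.contMDiff).continuousOn

/-- The source of the gluing map is `s ≠ 1/2`. [folklore] -/
theorem mappingTorusGlue_source : (mappingTorusGlue φ).source = {a | (a.2 : ℝ) ≠ 1 / 2} := rfl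

/-- The target of the gluing map is `t ≠ 1`. [folklore] -/
theorem mappingTorusGlue_target : (mappingTorusGlue φ).target = {b | (b.2 : ℝ) ≠ 1} := rfl

/-- The gluing map is `mtGlueFun φ`. [folklore] -/
theorem mappingTorusGlue_apply (a : M × mappingTorusPieceOne) : mappingTorusGlue φ a = mtGlueFun φ a :=
  rfl

/-- The inverse gluing map is `mtGlueInv φ.symm`. [folklore] -/
theorem mappingTorusGlue_symm_apply (b : M × mappingTorusPieceTwo) :
    (mappingTorusGlue φ).symm b = mtGlueInv φ.symm b := rfl

/-- **The graph of the mapping torus gluing map is `mappingTorusRel φ`.** [folklore] -/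
theorem mappingTorusRel_iff_glue (a : M × mappingTorusPieceOne) (b : M × mappingTorusPieceTwo) :
    mappingTorusRel φ a b ↔ a ∈ (mappingTorusGlue φ).source ∧ mappingTorusGlue φ a = b := by
  have hs := coe_prop_pieceOne a.2
  have ht := coe_prop_pieceTwo b.2
  rw [mappingTorusGlue_source, mappingTorusGlue_apply, mappingTorusRel]
  constructor
  · rintro (⟨h1, h2⟩ | ⟨h1, h2⟩)
    · have hgt : 1 / 2 < (a.2 : ℝ) := by rw [← h1]; exact ht.1
      refine ⟨hgt.ne', ?_⟩
      have h := mtGlueFun_fst_snd_of_gt (φ := φ) hgt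
      exact Prod.ext_pieceTwo (by rw [h.1, h2]) (by rw [h.2, h1])
    · have hlt : (a.2 : ℝ) < 1 / 2 := by linarith [ht.2]
      refine ⟨hlt.ne, ?_⟩
      have h := mtGlueFun_fst_snd_of_lt (φ := φ) hlt
      exact Prod.ext_pieceTwo (by rw [h.1, h2]) (by rw [h.2, h1])
  · rintro ⟨ha, rfl⟩
    rcases Ne.lt_or_gt ha with h | h
    · right
      have h' := mtGlueFun_fst_snd_of_lt (φ := φ) h
      exact ⟨h'.2, h'.1⟩
    · left
      have h' := mtGlueFun_fst_snd_of_gt (φ := φ) h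
      exact ⟨h'.2, h'.1⟩

/-- The graph of the gluing map is closed (for Hausdorff `M`): it is cut out by the closed
condition `mappingTorusRel`. [folklore] -/
theorem isClosed_graph_mappingTorusGlue [T2Space M] :
    IsClosed {p : (M × mappingTorusPieceOne) × (M × mappingTorusPieceTwo) |
      p.1 ∈ (mappingTorusGlue φ).source ∧ mappingTorusGlue φ p.1 = p.2} := by
  have heq : {p : (M × mappingTorusPieceOne) × (M × mappingTorusPieceTwo) |
      p.1 ∈ (mappingTorusGlue φ).source ∧ mappingTorusGlue φ p.1 = p.2} =
      ({p | ((p.2.2 : ℝ)) = p.1.2} ∩ {p | p.2.1 = p.1.1}) ∪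
        ({p | ((p.2.2 : ℝ)) = p.1.2 + 1} ∩ {p | p.2.1 = φ p.1.1}) := by
    ext p
    rw [mem_setOf_eq, ← mappingTorusRel_iff_glue, mappingTorusRel]
    simp only [mem_union, mem_inter_iff, mem_setOf_eq]
  rw [heq]
  have h1 : Continuous fun p : (M × mappingTorusPieceOne) × (M × mappingTorusPieceTwo) ↦
      (p.2.2 : ℝ) := by fun_prop
  have h2 : Continuous fun p : (M × mappingTorusPieceOne) × (M × mappingTorusPieceTwo) ↦
      (p.1.2 : ℝ) := by fun_prop
  refine ((isClosed_eq h1 h2).inter (isClosed_eq (by fun_prop) (by fun_prop))).union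
    ((isClosed_eq h1 (h2.add continuous_const)).inter
      (isClosed_eq (by fun_prop) (φ.continuous.comp (by fun_prop))))

end Glue

/-! ### The glued manifold -/

section Glued

variable [TopologicalSpace M] [ChartedSpace H M] (φ : M ≃ₘ⟮I, I⟯ M)
  {E_P : Type*} [NormedAddCommGroup E_P] [NormedSpace ℝ E_P] (L : (E × ℝ) ≃L[ℝ] E_P)

/-- **The gluing datum of the mapping torus** of `φ`, with model identification
`L : E × ℝ ≃L E_P`. [folklore] -/
def mappingTorusGlueData :
    SmoothGlueData (I.prod 𝓘(ℝ, ℝ)) (I.prod 𝓘(ℝ, ℝ)) (M × mappingTorusPieceOne)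
      (M × mappingTorusPieceTwo) E_P where
  glue := mappingTorusGlue φ
  contMDiffOn_glue := contMDiffOn_mtGlueFun φ.contMDiff
  contMDiffOn_glue_symm := contMDiffOn_mtGlueInv φ.symm.contMDiff
  linA := L
  linB := L

/-- The gluing map of the mapping torus datum is `mappingTorusGlue φ`. [folklore] -/
@[simp] theorem mappingTorusGlueData_glue : (mappingTorusGlueData φ L).glue = mappingTorusGlue φ := rfl

/-- **The smooth mapping torus** `T_φ = M × (0, 1) ∪_glue M × (1/2, 3/2)` of `φ`, charted on `E_P`
(Cappell–Shaneson 1976, §1). [folklore] -/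
abbrev MappingTorusGlued : Type u := (mappingTorusGlueData φ L).Glued

/-- The mapping torus is Hausdorff (for Hausdorff `M`). [folklore] -/
instance t2Space_mappingTorusGlued [T2Space M] : T2Space (MappingTorusGlued φ L) :=
  (mappingTorusGlueData φ L).t2Space_of_isClosed_graph (isClosed_graph_mappingTorusGlue φ)

/-- The compact piece `M × [1/4, 3/4]` of the first cylinder. [folklore] -/
def mtCptA : Set (M × mappingTorusPieceOne) := {a | (a.2 : ℝ) ∈ Icc (1 / 4 : ℝ) (3 / 4)}

/-- The compact piece `M × [3/4, 5/4]` of the second cylinder. [folklore] -/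
def mtCptB : Set (M × mappingTorusPieceTwo) := {b | (b.2 : ℝ) ∈ Icc (3 / 4 : ℝ) (5 / 4)}

/-- `M × [1/4, 3/4]` is compact for compact `M`. [folklore] -/
theorem isCompact_mtCptA [CompactSpace M] : IsCompact (mtCptA (M := M)) := by
  have hK : IsCompact ((Subtype.val : mappingTorusPieceOne → ℝ) ⁻¹' Icc (1 / 4 : ℝ) (3 / 4)) := by
    refine Topology.IsInducing.subtypeVal.isCompact_preimage' isCompact_Icc ?_
    rintro s ⟨h1, h2⟩
    exact ⟨⟨s, mem_mappingTorusPieceOne.2 ⟨by linarith, by linarith⟩⟩, rfl⟩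
  have : mtCptA (M := M) = univ ×ˢ ((Subtype.val : mappingTorusPieceOne → ℝ) ⁻¹' Icc (1 / 4 : ℝ) (3 / 4)) := by
    ext a; simp [mtCptA]
  rw [this]
  exact isCompact_univ.prod hK

/-- `M × [3/4, 5/4]` is compact for compact `M`. [folklore] -/
theorem isCompact_mtCptB [CompactSpace M] : IsCompact (mtCptB (M := M)) := by
  have hK : IsCompact ((Subtype.val : mappingTorusPieceTwo → ℝ) ⁻¹' Icc (3 / 4 : ℝ) (5 / 4)) := by
    refine Topology.IsInducing.subtypeVal.isCompact_preimage' isCompact_Icc ?_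
    rintro t ⟨h1, h2⟩
    exact ⟨⟨t, mem_mappingTorusPieceTwo.2 ⟨by linarith, by linarith⟩⟩, rfl⟩
  have : mtCptB (M := M) = univ ×ˢ ((Subtype.val : mappingTorusPieceTwo → ℝ) ⁻¹' Icc (3 / 4 : ℝ) (5 / 4)) := by
    ext b; simp [mtCptB]
  rw [this]
  exact isCompact_univ.prod hK

/-- **The mapping torus of a compact manifold is compact**: it is covered by the images of
`M × [1/4, 3/4]` and `M × [3/4, 5/4]`. [folklore] -/
instance compactSpace_mappingTorusGlued [CompactSpace M] : CompactSpace (MappingTorusGlued φ L) := by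
  refine (mappingTorusGlueData φ L).compactSpace_of_forall_not_mem isCompact_mtCptA isCompact_mtCptB
    ?_ ?_
  · intro a ha
    have hs := coe_prop_pieceOne a.2
    simp only [mtCptA, mem_setOf_eq, mem_Icc, not_and_or, not_le] at ha
    simp only [mappingTorusGlueData_glue, mappingTorusGlue_source, mem_setOf_eq,
      mappingTorusGlue_apply, mtCptB, mem_Icc]
    rcases ha with h | h
    · have hlt : (a.2 : ℝ) < 1 / 2 := by linarith
      refine ⟨hlt.ne, ?_⟩
      rw [(mtGlueFun_fst_snd_of_lt hlt).2]; constructor <;> linarith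
    · have hgt : 1 / 2 < (a.2 : ℝ) := by linarith
      refine ⟨hgt.ne', ?_⟩
      rw [(mtGlueFun_fst_snd_of_gt hgt).2]; constructor <;> linarith
  · intro b hb
    have ht := coe_prop_pieceTwo b.2
    simp only [mtCptB, mem_setOf_eq, mem_Icc, not_and_or, not_le] at hb
    simp only [mappingTorusGlueData_glue, mappingTorusGlue_target, mem_setOf_eq,
      mappingTorusGlue_symm_apply, mtCptA, mem_Icc]
    rcases hb with h | h
    · have hlt : (b.2 : ℝ) < 1 := by linarith
      refine ⟨hlt.ne, ?_⟩
      rw [(mtGlueInv_fst_snd_of_lt hlt).2]; constructor <;> linarith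
    · have hgt : 1 < (b.2 : ℝ) := by linarith
      refine ⟨hgt.ne', ?_⟩
      rw [(mtGlueInv_fst_snd_of_gt hgt).2]; constructor <;> linarith

variable [I.Boundaryless] [IsManifold I ∞ M]

/-- The mapping torus of a compact manifold is second countable (when the model is). [folklore] -/
instance secondCountable_mappingTorusGlued [CompactSpace M] [SecondCountableTopology E_P] :
    SecondCountableTopology (MappingTorusGlued φ L) :=
  (mappingTorusGlueData φ L).secondCountableTopology

/-- **The glued mapping torus is an open gluing of the two cylinders along `mappingTorusRel φ`**,
with witnesses the canonical maps `inl`, `inr` (Cappell–Shaneson 1976, §1). [folklore] -/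
theorem isOpenGluingWith_mappingTorusGlued :
    IsOpenGluingWith (I.prod 𝓘(ℝ, ℝ)) (I.prod 𝓘(ℝ, ℝ)) 𝓘(ℝ, E_P) (mappingTorusRel φ)
      (mappingTorusGlueData φ L).inl (mappingTorusGlueData φ L).inr :=
  (mappingTorusGlueData φ L).isOpenGluingWith (mappingTorusRel_iff_glue φ)

/-- The glued mapping torus is a smooth mapping torus of `φ` in the sense of `IsMappingTorusOf`. [folklore] -/
theorem isMappingTorusOf_mappingTorusGlued :
    IsMappingTorusOf 𝓘(ℝ, E_P) (MappingTorusGlued φ L) φ :=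
  (isOpenGluingWith_mappingTorusGlued φ L).isOpenGluing

omit [I.Boundaryless] [IsManifold I ∞ M] in
/-- The gluing identification in the mapping torus, in terms of `mappingTorusRel`. [folklore] -/
theorem mappingTorusGlued_inl_eq_inr_iff (a : M × mappingTorusPieceOne) (b : M × mappingTorusPieceTwo) :
    (mappingTorusGlueData φ L).inl a = (mappingTorusGlueData φ L).inr b ↔ mappingTorusRel φ a b :=
  ((mappingTorusGlueData φ L).inl_eq_inr_iff).trans (mappingTorusRel_iff_glue φ a b).symm

end Glued

end Literature.Topology.FourManifolds
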